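import Summits.ABC.IUTFork.Thm311RealInd1StripPacketFloor
import Summits.ABC.IUTFork.Thm311RealInd1StripPacketCeiling
import Literature.IUT.LogVolume.TensorPacketLogStar
import Literature.IUT.LogVolume.GenuineLogThetaPerImageSubIndeterminacy
import HarnessLib

/-!
# [IUTchIII] Thm 3.11 (i) (Ind1)+(Ind2) ⟶ Cor 3.12 Step (x)/(xi), reading (P): THE PACKET–THETA JUNCTION — modulo
# `JannsenWingbergMappingClass`, at a genuine place-section packet all of whose factors are TAME of ODD local degree `≥ 3` with residue
# degree `≠ 1`, the `(R_I)^∼`-hull of the orbit of the Θ-region `O_𝕃(−P_Θ)_{v⃗} = ι_j(t)·(R_I)^∼` under ANY sub-indeterminacy of the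
# Dupuy–Hilado container containing print's single-factor (Ind1) strip moves EQUALS the hull of the container orbit (the slot images)

PROOF-ONLY file (abc-iut cell, Cor. 3.12 sub-crew, seat abc-iut-c312-1 = holder of record of the typed [IUTchIII] Thm. 3.11, gen 16; row
«R21 = C:PACKET-THETA-JUNCTION», C LEAD ruling C-R131 (e)).  TAKES NO SIDE on [IUTchIII] Cor. 3.12.  No definition, no `Prop` fact, no new
named fact: `JannsenWingbergMappingClass` (`Literature/AnabelianGeometry/AbsoluteAnabelian/MLFGaloisJannsenWingbergTwists`) is the ONLY
conditional input and stays a displayed binder `hMC`.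

* §0 bookkeeping on any packet `V = ⊗_{ℚ_p} k_i`: the hull of an additive span; the container `indTwo` fixes every `a·log_p(R_I^×)`, so the hull of
  the orbit of a region `M ⊆ a·log_p(R_I^×)` under any `H ≤ indTwo` lies in `packetHull(a·log_p(R_I^×))`; the span of an `H`-orbit is `H`-stable.
* §1 genuine packet `X = ⊗_{ℚ_p, i} K_{w_i}` (abc-iut-S7 rescaled completions), twist `ι_{i₀}(g)·(R_I)^∼`, `‖g‖ = p^{−v/e_{i₀}}`, every factor TAME:
  CONTAINER SIDE `packetHull_iUnion_image_iota_smul_normalizedPacket_subset_of_tame` — `ι_{i₀}(g)·(R_I)^∼ ⊆ p^{A}·log_p(R_I^×)`,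
  **`A = (v − 1) div e_{i₀} + 1 − |I|`**, by [IUTchIV] Prop. 1.2 (ii) in the STAR form at `* = i₀` (abc-iut-w4-d006
  `iota_smul_normalizedPacket_subset_zpow_smul_logPacket_of_star` + `floor_star_of_tame'`), UNCONDITIONAL, for EVERY integral structure
  (`(R_I)^∼ = R_I` or not); PRINT SIDE **`packetHull_iUnion_image_iota_smul_normalizedPacket_eq_of_jannsenWingbergMappingClass`** — for every
  `H ≤ indTwo` CONTAINING the single-factor strip moves `⊗ z ↦ ⊗ z[i₁ ↦ ψ z_{i₁}]`, `ψ ∈ Real.ind1StripOf w_{i₁} (galoisLog w_{i₁})` (print's (Ind1)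
  strip part at one factor, the others fixed — p516014's `hg` shape), factors of ODD local degree `≥ 3` and `f(w_i|p) ≠ 1`:
  `packetHull(⋃_{γ ∈ H} γ(ι_{i₀}(g)·(R_I)^∼)) = packetHull(p^{A}·log_p(R_I^×))` — the pure tensors of the BOX `ι_{i₀}(g)·R_I` (abc-iut-S1
  `purePacket_mem_integerPacket`) are the products of the factor balls `p⁻¹·𝔪^{e_i}` (`i ≠ i₀`) and `p^{(v−1) div e}·𝔪^{(v−1) mod e + 1}` (`i = i₀`),
  of total content `p^{A}`, and gen 15's PACKET FLOOR `packetHull_eq_of_balls_of_jannsenWingbergMappingClass` (p535531) applies to the additive span of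
  the `H`-orbit (inside `packetHull(p^A·log_p(R_I^×))` by the container side).  So `hull(p^A·L) ⊆ hull(H-orbit) ⊆ hull(container orbit) ⊆ hull(p^A·L)`.
* §2 **`localFields_packetHull_orbitH_pilotRegion_eq_slotImagesHull_of_jannsenWingbergMappingClass`** — in abc-iut-c312-d1's vocabulary
  (`realPrimePacketWith p (σ.localFields p) c`, the real prime packet over the GENUINE completions of a place section, any shell normalisation;
  Θ-idele `t`; degree `j = i+1`, collection `v⃗`): the `(R_I)^∼`-hull of the `H`-orbit of `O_𝕃(−P_Θ)_{v⃗}` EQUALS `slotImagesHull` (reading (P)'s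
  region) for every such `H` — in particular for print's factorwise (Ind1)-strip ⊔ (Ind2) group (`≤ indTwo` by p516014
  `mem_indTwo_of_printInd1Ind2`).  The `ln ν̄_{𝕃_p}`-level identity with `−|log(Θ)|^{(P)}_p` (gen 15's criterion p534943 §3), the explicit value
  and the non-vacuity witness are the sequel `Thm311RealInd1StripPacketThetaJunctionVolume`.

PRICING CAVEAT OF RECORD, RETIRED (gen 15 HANDOFF OPEN (i): «`Π_b c_b` matches DH's content `p^m` only when `(R_I)^∼ = R_I`»): by the star form
the content of `ι_j(t)·(R_I)^∼` at a tame tuple is `≥ A` for every integral structure and the box certifies `A`, so no sandwich is left.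
RESIDUES (displayed): the unit-ball factors `𝒪 = p⁻¹·𝔪^{e}` are the depth-`n = e` case of the single-place floor, so `f ≠ 1` is REQUIRED
(hypothesis `hf`; automatic at unramified factors of degree `≥ 3`; at `i₀` needed only when `e_{i₀} ∣ v`); EVEN local degree — no printed
mapping-class sentence, NOT typed (gap of record); WILD factors; `p = 2`.  HONEST SCOPE: statements about OUR typings — print's (Ind1) strip part
read through THE equivariant lift and THE logarithm (R8/R9), factorwise action as in p516014, the hull = abc-iut-S2's `(R_I)^∼`-span; whether print's
EFFECTIVE indeterminacies at `v ∈ 𝕍^bad` are these is referee finding F-B28-1's reading matter, untouched; a conditional theorem discharges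
nothing it binds; (Ind3), the log-link and Cor. 3.12 itself untouched; equal-AS-TYPED ≠ equal in print; nothing here asserts that abc is
proved or refuted; no side taken. [claim: Mochizuki2012, status: disputed]; [cite: Mochizuki2012, IUTchIII Thm. 3.11 (i) p. 154; Rmk. 3.9.5 (i)
p. 127; Cor. 3.12 Step (x)/(xi) pp. 181–183; IUTchIV Prop. 1.2 (ii) p. 10–11, Prop. 1.4 (i) p. 13]; [cite: Kondo2025OuterAutMLF, §3 Thm 3.17,
Rem 3.18]; [cite: DupuyHilado2025, §4.9, §4.12]. typed ≠ proved.
-/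

set_option autoImplicit false

noncomputable section

open Metric Set Function
open scoped Pointwise TensorProduct

namespace Summit.ABC.IUTFork.Thm311.Real

open NumberField IsDedekindDomain Literature.NumberTheory.NumberFields Literature.IUT.LogVolume
open Literature.NumberTheory.GaloisRepresentations Literature.NumberTheory.GaloisRepresentations.Ultrametric
open Literature.AnabelianGeometry.AbsoluteAnabelian Literature.IUT.HodgeArakelov
open Literature.IUT.HodgeArakelov.AbsTopMonoids

/-! ## §0 Packet-level bookkeeping (any family of fields) -/

section Packet

variable (p : ℕ) [Fact p.Prime] {I : Type}
variable (k : I → Type) [∀ i, NontriviallyNormedField (k i)] [∀ i, NormedAlgebra ℚ_[p] (k i)]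

/-- The `(R_I)^∼`-hull of the additive span of a set is the hull of the set (the hull is an `(R_I)^∼`-submodule).
[cite: DupuyHilado2025, Rmk. 4.12.1] -/
theorem packetHull_coe_closure_eq (S : Set (PacketAlgebra p k)) :
    packetHull p k (AddSubgroup.closure S : Set (PacketAlgebra p k)) = packetHull p k S := by
  refine Set.Subset.antisymm ?_ (packetHull_mono p k AddSubgroup.subset_closure)
  have h : (AddSubgroup.closure S : Set (PacketAlgebra p k)) ⊆ packetHull p k S :=
    (AddSubgroup.closure_le ((packetSpan p k S).toAddSubgroup)).mpr (subset_packetHull p k S)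
  calc packetHull p k (AddSubgroup.closure S : Set (PacketAlgebra p k))
      ⊆ packetHull p k (packetHull p k S) := packetHull_mono p k h
    _ = packetHull p k S := packetHull_packetHull p k S

/-- A container element maps every scalar multiple `a·log_p(R_I^×)` onto itself. [cite: DupuyHilado2025, §4.9] -/
theorem image_const_smul_logPacket_of_mem_indTwo {g : PacketAlgebra p k ≃ₗ[ℚ_[p]] PacketAlgebra p k}
    (hg : g ∈ indTwo p k) (a : ℚ_[p]) :
    g '' (a • (logPacket p k : Set (PacketAlgebra p k))) = a • (logPacket p k : Set (PacketAlgebra p k)) := by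
  rw [image_const_smul, image_logPacket_of_mem p k hg]

/-- **The `(R_I)^∼`-hull of the orbit of a region `M ⊆ a·log_p(R_I^×)` under ANY sub-indeterminacy `H ≤ indTwo` of the Dupuy–Hilado container
lies in `packetHull(a·log_p(R_I^×))`** (the container preserves `a·log_p(R_I^×)`). [cite: DupuyHilado2025, §4.9, §4.12] -/
theorem packetHull_iUnion_image_subset_of_subset_smul_logPacket {M : Set (PacketAlgebra p k)} {a : ℚ_[p]}
    (hM : M ⊆ a • (logPacket p k : Set (PacketAlgebra p k)))
    (H : Subgroup (PacketAlgebra p k ≃ₗ[ℚ_[p]] PacketAlgebra p k)) (hH : H ≤ indTwo p k) :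
    packetHull p k (⋃ g : H, (g : PacketAlgebra p k ≃ₗ[ℚ_[p]] PacketAlgebra p k) '' M) ⊆
      packetHull p k (a • (logPacket p k : Set (PacketAlgebra p k))) := by
  refine packetHull_mono p k (Set.iUnion_subset fun g => ?_)
  calc (g : PacketAlgebra p k ≃ₗ[ℚ_[p]] PacketAlgebra p k) '' M
      ⊆ (g : PacketAlgebra p k ≃ₗ[ℚ_[p]] PacketAlgebra p k) '' (a • (logPacket p k : Set (PacketAlgebra p k))) :=
        Set.image_mono hM
    _ = a • (logPacket p k : Set (PacketAlgebra p k)) := image_const_smul_logPacket_of_mem_indTwo p k (hH g.2) a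

/-- The additive span of the orbit `⋃_{g ∈ H} g(S)` is mapped into itself by every `g₀ ∈ H`. [folklore] -/
theorem map_closure_iUnion_image_le (S : Set (PacketAlgebra p k)) (H : Subgroup (PacketAlgebra p k ≃ₗ[ℚ_[p]] PacketAlgebra p k))
    {g₀ : PacketAlgebra p k ≃ₗ[ℚ_[p]] PacketAlgebra p k} (hg₀ : g₀ ∈ H) :
    (AddSubgroup.closure (⋃ g : H, (g : PacketAlgebra p k ≃ₗ[ℚ_[p]] PacketAlgebra p k) '' S)).map
        (g₀ : PacketAlgebra p k →+ PacketAlgebra p k) ≤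
      AddSubgroup.closure (⋃ g : H, (g : PacketAlgebra p k ≃ₗ[ℚ_[p]] PacketAlgebra p k) '' S) := by
  rw [AddMonoidHom.map_closure]
  refine AddSubgroup.closure_mono ?_
  rintro _ ⟨z, hz, rfl⟩
  obtain ⟨g, hg⟩ := Set.mem_iUnion.mp hz
  obtain ⟨s, hs, rfl⟩ := hg
  exact Set.mem_iUnion.mpr ⟨⟨g₀, hg₀⟩ * g, ⟨s, hs, rfl⟩⟩

end Packet

/-! ## §1 The genuine packet `⊗_{ℚ_p, i} K_{w_i}`: container side (star form) and print side (packet floor) of the twist `ι_{i₀}(g)·(R_I)^∼` -/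

section GenuineFactors

variable {K : Type} [Field K] [NumberField K] (p : ℕ) [hp : Fact p.Prime]
variable {I : Type} [Fintype I] [DecidableEq I] (w : I → HeightOneSpectrum (𝓞 K)) (hw : ∀ i, ((p : ℕ) : 𝓞 K) ∈ (w i).asIdeal)

/-- **CONTAINER SIDE — [IUTchIV] Prop. 1.2 (ii) in the star form at a TAME tuple.**  On `X = ⊗_{ℚ_p, i} K_{w_i}` (genuine completions, every
factor tame: `p > 2`, `e_i ≤ p − 2`), for `g ∈ K_{w_{i₀}}` with `‖g‖ = p^{−v/e_{i₀}}`: `ι_{i₀}(g)·(R_I)^∼ ⊆ p^{A}·log_p(R_I^×)` with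
`A = (v − 1) div e_{i₀} + 1 − |I|` (abc-iut-w4-d006 `iota_smul_normalizedPacket_subset_zpow_smul_logPacket_of_star` + `floor_star_of_tame'`);
hence the `(R_I)^∼`-hull of the orbit of the twist under ANY sub-indeterminacy `H ≤ indTwo` lies in `packetHull(p^A·log_p(R_I^×))`.
[cite: Mochizuki2012, IUTchIV Prop. 1.2 (ii) p. 10–11] [cite: DupuyHilado2025, §4.9, §4.12] [claim: Mochizuki2012, status: disputed] -/
theorem packetHull_iUnion_image_iota_smul_normalizedPacket_subset_of_tame (hp2 : 2 < p)
    (he : ∀ i, absRamificationIdx p (RescaledCompletion K p (w i) (hw i)) ≤ p - 2) (i₀ : I)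
    {g : RescaledCompletion K p (w i₀) (hw i₀)} {v : ℤ}
    (hv : ‖g‖ = (p : ℝ) ^ (-(v / (absRamificationIdx p (RescaledCompletion K p (w i₀) (hw i₀)) : ℝ))))
    (H : Subgroup (PacketAlgebra p (fun i => RescaledCompletion K p (w i) (hw i)) ≃ₗ[ℚ_[p]]
      PacketAlgebra p (fun i => RescaledCompletion K p (w i) (hw i))))
    (hH : H ≤ indTwo p (fun i => RescaledCompletion K p (w i) (hw i))) :
    iota p (fun i => RescaledCompletion K p (w i) (hw i)) i₀ g •
        (normalizedPacket p (fun i => RescaledCompletion K p (w i) (hw i)) :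
          Set (PacketAlgebra p (fun i => RescaledCompletion K p (w i) (hw i)))) ⊆
      ((p : ℚ_[p]) ^ ((v - 1) / (absRamificationIdx p (RescaledCompletion K p (w i₀) (hw i₀)) : ℤ) + 1 - Fintype.card I)) •
        (logPacket p (fun i => RescaledCompletion K p (w i) (hw i)) :
          Set (PacketAlgebra p (fun i => RescaledCompletion K p (w i) (hw i)))) ∧
    packetHull p (fun i => RescaledCompletion K p (w i) (hw i))
        (⋃ γ : H, (γ : PacketAlgebra p (fun i => RescaledCompletion K p (w i) (hw i)) ≃ₗ[ℚ_[p]]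
            PacketAlgebra p (fun i => RescaledCompletion K p (w i) (hw i))) ''
          (iota p (fun i => RescaledCompletion K p (w i) (hw i)) i₀ g •
            (normalizedPacket p (fun i => RescaledCompletion K p (w i) (hw i)) :
              Set (PacketAlgebra p (fun i => RescaledCompletion K p (w i) (hw i)))))) ⊆
      packetHull p (fun i => RescaledCompletion K p (w i) (hw i))
        (((p : ℚ_[p]) ^ ((v - 1) / (absRamificationIdx p (RescaledCompletion K p (w i₀) (hw i₀)) : ℤ) + 1 - Fintype.card I)) •
          (logPacket p (fun i => RescaledCompletion K p (w i) (hw i)) :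
            Set (PacketAlgebra p (fun i => RescaledCompletion K p (w i) (hw i))))) := by
  set k := fun i => RescaledCompletion K p (w i) (hw i) with hk
  have hA : ⌊(v : ℝ) / absRamificationIdx p (k i₀) - (dSum p k - differentOrd p (k i₀)) - aSum p k⌋ =
      (v - 1) / (absRamificationIdx p (k i₀) : ℤ) + 1 - Fintype.card I := floor_star_of_tame' p k hp2 he i₀ v
  have hMA : iota p k i₀ g • (normalizedPacket p k : Set (PacketAlgebra p k)) ⊆
      ((p : ℚ_[p]) ^ ((v - 1) / (absRamificationIdx p (k i₀) : ℤ) + 1 - Fintype.card I)) • (logPacket p k : Set (PacketAlgebra p k)) := by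
    rw [← hA]
    exact iota_smul_normalizedPacket_subset_zpow_smul_logPacket_of_star p k i₀ i₀ hv
  exact ⟨hMA, packetHull_iUnion_image_subset_of_subset_smul_logPacket p k hMA H hH⟩

/-- **PRINT SIDE — THE JUNCTION at the packet (modulo `JannsenWingbergMappingClass`).**  Same packet, every factor TAME of ODD local degree
`≥ 3` with residue degree `f(w_i|p) ≠ 1`; `‖g‖ = p^{−v/e_{i₀}}`.  For every subgroup `H` of `Aut_{ℚ_p}(X)` INSIDE the container
(`H ≤ indTwo`) and CONTAINING the single-factor strip moves `⊗ z ↦ ⊗ z[i₁ ↦ ψ z_{i₁}]`, `ψ ∈ Real.ind1StripOf w_{i₁} (galoisLog w_{i₁})`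
(print's (Ind1) strip part at one factor, the others fixed): the `(R_I)^∼`-hull of the `H`-orbit of the twist `ι_{i₀}(g)·(R_I)^∼` IS
`packetHull(p^{A}·log_p(R_I^×))`, `A = (v − 1) div e_{i₀} + 1 − |I|`.  Container side: the previous lemma; print side: the pure tensors of the
BOX `ι_{i₀}(g)·R_I` (`‖a_i‖ ≤ 1` off `i₀`, `‖a_{i₀}‖ ≤ ‖g‖`) are the products of the factor balls `p⁻¹·𝔪^{e_i}` (`i ≠ i₀`) and
`p^{(v−1) div e}·𝔪^{(v−1) mod e + 1}` (`i = i₀`), of total content `p^{A}`, and gen 15's packet floor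
`packetHull_eq_of_balls_of_jannsenWingbergMappingClass` applies to the additive span of the `H`-orbit. [claim: Mochizuki2012, status: disputed]
[cite: Mochizuki2012, IUTchIII Thm. 3.11 (i) p. 154; Rmk. 3.9.5 (i) p. 127; Cor. 3.12 Step (xi) p. 183; IUTchIV Prop. 1.2 (ii) p. 10–11]
[cite: Kondo2025OuterAutMLF, §3 Thm 3.17, Rem 3.18] [cite: DupuyHilado2025, §4.9, §4.12] -/
theorem packetHull_iUnion_image_iota_smul_normalizedPacket_eq_of_jannsenWingbergMappingClass [Nonempty I]
    (hMC : JannsenWingbergMappingClass) (hp2 : 2 < p)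
    (he : ∀ i, absRamificationIdx p (RescaledCompletion K p (w i) (hw i)) ≤ p - 2)
    (h3 : ∀ i, 3 ≤ localDeg K (w i)) (hodd : ∀ i, Odd (localDeg K (w i))) (hf : ∀ i, (w i).asIdeal.inertiaDeg ℤ ≠ 1)
    (i₀ : I) {g : RescaledCompletion K p (w i₀) (hw i₀)} {v : ℤ}
    (hv : ‖g‖ = (p : ℝ) ^ (-(v / (absRamificationIdx p (RescaledCompletion K p (w i₀) (hw i₀)) : ℝ))))
    (H : Subgroup (PacketAlgebra p (fun i => RescaledCompletion K p (w i) (hw i)) ≃ₗ[ℚ_[p]]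
      PacketAlgebra p (fun i => RescaledCompletion K p (w i) (hw i))))
    (hH : H ≤ indTwo p (fun i => RescaledCompletion K p (w i) (hw i)))
    (hstrip : ∀ (i₁ : I), ∀ ψ ∈ ind1StripOf (w i₁) (galoisLog (w i₁)), ∃ γ ∈ H,
      ∀ z : Π i, RescaledCompletion K p (w i) (hw i),
        (γ : PacketAlgebra p (fun i => RescaledCompletion K p (w i) (hw i)) ≃ₗ[ℚ_[p]]
            PacketAlgebra p (fun i => RescaledCompletion K p (w i) (hw i))) (PiTensorProduct.tprod ℚ_[p] z) =
          PiTensorProduct.tprod ℚ_[p] (update z i₁ (RescaledCompletion.of K p (w i₁) (hw i₁)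
            (ψ ((RescaledCompletion.of K p (w i₁) (hw i₁)).symm (z i₁)))))) :
    packetHull p (fun i => RescaledCompletion K p (w i) (hw i))
        (⋃ γ : H, (γ : PacketAlgebra p (fun i => RescaledCompletion K p (w i) (hw i)) ≃ₗ[ℚ_[p]]
            PacketAlgebra p (fun i => RescaledCompletion K p (w i) (hw i))) ''
          (iota p (fun i => RescaledCompletion K p (w i) (hw i)) i₀ g •
            (normalizedPacket p (fun i => RescaledCompletion K p (w i) (hw i)) :
              Set (PacketAlgebra p (fun i => RescaledCompletion K p (w i) (hw i)))))) =
      packetHull p (fun i => RescaledCompletion K p (w i) (hw i))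
        (((p : ℚ_[p]) ^ ((v - 1) / (absRamificationIdx p (RescaledCompletion K p (w i₀) (hw i₀)) : ℤ) + 1 - Fintype.card I)) •
          (logPacket p (fun i => RescaledCompletion K p (w i) (hw i)) :
            Set (PacketAlgebra p (fun i => RescaledCompletion K p (w i) (hw i))))) := by
  classical
  set k := fun i => RescaledCompletion K p (w i) (hw i) with hk
  set e := fun i => RescaledCompletion.of K p (w i) (hw i) with he_def
  set E : ℕ := absRamificationIdx p (k i₀) with hE
  set A : ℤ := (v - 1) / (E : ℤ) + 1 - Fintype.card I with hA
  set L : Set (PacketAlgebra p k) := (logPacket p k : Set (PacketAlgebra p k)) with hL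
  set M : Set (PacketAlgebra p k) := iota p k i₀ g • (normalizedPacket p k : Set (PacketAlgebra p k)) with hM
  set O : Set (PacketAlgebra p k) := ⋃ γ : H, (γ : PacketAlgebra p k ≃ₗ[ℚ_[p]] PacketAlgebra p k) '' M with hO
  set N : AddSubgroup (PacketAlgebra p k) := AddSubgroup.closure O with hN
  have hP : p.Prime := Fact.out
  have hp0 : (0 : ℝ) < p := by exact_mod_cast hP.pos
  have hpQ : (p : ℚ_[p]) ≠ 0 := by exact_mod_cast hP.ne_zero
  have hE0 : 0 < E := absRamificationIdx_pos p (k i₀)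
  have hE0z : (0 : ℤ) < (E : ℤ) := by exact_mod_cast hE0
  have hg0 : g ≠ 0 := norm_pos_iff.mp (by rw [hv]; positivity)
  -- container side: `M ⊆ p^A·L`, hence `O ⊆ p^A·L` and `N ⊆ p^A·L ⊆ packetHull(p^A·L)`
  obtain ⟨hMA, hOA'⟩ := packetHull_iUnion_image_iota_smul_normalizedPacket_subset_of_tame p w hw hp2 he i₀ hv H hH
  have hOA : O ⊆ ((p : ℚ_[p]) ^ A) • L := by
    refine Set.iUnion_subset fun γ => ?_
    calc (γ : PacketAlgebra p k ≃ₗ[ℚ_[p]] PacketAlgebra p k) '' M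
        ⊆ (γ : PacketAlgebra p k ≃ₗ[ℚ_[p]] PacketAlgebra p k) '' (((p : ℚ_[p]) ^ A) • L) := Set.image_mono hMA
      _ = ((p : ℚ_[p]) ^ A) • L := image_const_smul_logPacket_of_mem_indTwo p k (hH γ.2) _
  have hNA : (N : Set (PacketAlgebra p k)) ⊆ ((p : ℚ_[p]) ^ A) • L := by
    have h : N ≤ ((p : ℚ_[p]) ^ A) • logPacket p k :=
      (AddSubgroup.closure_le _).mpr (by rw [AddSubgroup.coe_pointwise_smul]; exact hOA)
    intro x hx
    have hx' : x ∈ ((p : ℚ_[p]) ^ A) • logPacket p k := h hx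
    rwa [← SetLike.mem_coe, AddSubgroup.coe_pointwise_smul] at hx'
  -- the box data: depth `n = (v−1) mod e + 1` and content `p^{(v−1) div e}` at `i₀`, `p⁻¹·𝔪^{e_i}` elsewhere
  set a : ℤ := (v - 1) / (E : ℤ) with ha
  set r : ℤ := (v - 1) % (E : ℤ) with hr
  have hr0 : 0 ≤ r := Int.emod_nonneg _ hE0z.ne'
  have hrE : r < E := Int.emod_lt_of_pos _ hE0z
  have hvar : v - 1 = (E : ℤ) * a + r := by rw [hr, Int.emod_def]; ring
  set n : ℕ := r.toNat + 1 with hn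
  have hnr : (n : ℤ) = r + 1 := by rw [hn, Nat.cast_add, Nat.cast_one, Int.toNat_of_nonneg hr0]
  have hn1 : 1 ≤ n := Nat.le_add_left 1 _
  have hnE : n ≤ E := by omega
  have hvR : (v : ℝ) = (E : ℝ) * a + n := by
    have h1 : v = (E : ℤ) * a + n := by rw [hnr]; omega
    exact_mod_cast h1
  let cc : I → ℚ_[p] := fun i => if i = i₀ then (p : ℚ_[p]) ^ a else (p : ℚ_[p])⁻¹
  let nn : I → ℕ := fun i => if i = i₀ then n else absRamificationIdx p (k i)
  have hcc0 : ∀ i, cc i ≠ 0 := by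
    intro i; by_cases hi : i = i₀
    · simp only [cc, if_pos hi]; exact zpow_ne_zero _ hpQ
    · simp only [cc, if_neg hi]; exact inv_ne_zero hpQ
  have hnn1 : ∀ i, 1 ≤ nn i := by
    intro i; by_cases hi : i = i₀
    · simp only [nn, if_pos hi]; exact hn1
    · simp only [nn, if_neg hi]; exact absRamificationIdx_pos p (k i)
  have hnne : ∀ i, nn i ≤ absRamificationIdx p (k i) := by
    intro i; by_cases hi : i = i₀
    · subst hi; simp only [nn, if_pos rfl]; exact hnE
    · simp only [nn, if_neg hi]; exact le_rfl
  have hexc : ∀ i, ¬ (nn i = absRamificationIdx p (k i) ∧ (w i).asIdeal.inertiaDeg ℤ = 1) := fun i hi => hf i hi.2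
  -- radii of the box: `‖g‖` at `i₀`, `1` elsewhere
  have hrad₀ : ‖cc i₀‖ * (p : ℝ) ^ (-((nn i₀ : ℝ) / (absRamificationIdx p (k i₀) : ℝ))) = ‖g‖ := by
    simp only [cc, nn, if_pos rfl]
    rw [hv, norm_zpow, Padic.norm_p, inv_zpow', ← Real.rpow_intCast, ← Real.rpow_add hp0]
    congr 1
    have hE0r : (E : ℝ) ≠ 0 := by exact_mod_cast hE0.ne'
    rw [show (absRamificationIdx p (RescaledCompletion K p (w i₀) (hw i₀)) : ℝ) = E from rfl, hvR]
    push_cast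
    field_simp
    ring
  have hrad : ∀ i, i ≠ i₀ → ‖cc i‖ * (p : ℝ) ^ (-((nn i : ℝ) / (absRamificationIdx p (k i) : ℝ))) = 1 := by
    intro i hi
    simp only [cc, nn, if_neg hi]
    have hEi : (absRamificationIdx p (k i) : ℝ) ≠ 0 := by exact_mod_cast (absRamificationIdx_pos p (k i)).ne'
    rw [norm_inv, Padic.norm_p, inv_inv, div_self hEi, Real.rpow_neg_one, mul_inv_cancel₀ hp0.ne']
  -- the pure tensors of the box lie in `M ⊆ O ⊆ N`
  have hMO : M ⊆ O := by
    intro x hx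
    refine Set.mem_iUnion.mpr ⟨(1 : H), ?_⟩
    rw [OneMemClass.coe_one, LinearEquiv.coe_one, Set.image_id]
    exact hx
  have hbox : ∀ x : Π i, (w i).adicCompletion K,
      (∀ i, ‖e i (x i)‖ ≤ ‖cc i‖ * (p : ℝ) ^ (-((nn i : ℝ) / (absRamificationIdx p (k i) : ℝ)))) →
      PiTensorProduct.tprod ℚ_[p] (fun i => e i (x i)) ∈ N := by
    intro x hx
    refine AddSubgroup.subset_closure (hMO ?_)
    -- `⊗ x = ι_{i₀}(g)·⊗ y`, `y = x[i₀ ↦ g⁻¹ x_{i₀}]`, `y` integral in every factor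
    let y : Π i, k i := update (fun i => e i (x i)) i₀ (g⁻¹ * e i₀ (x i₀))
    have hy1 : ∀ i, ‖y i‖ ≤ 1 := by
      intro i; by_cases hi : i = i₀
      · subst hi
        simp only [y, update_self]
        rw [norm_mul, norm_inv, inv_mul_le_iff₀ (norm_pos_iff.mpr hg0), mul_one, ← hrad₀]
        exact hx _
      · simp only [y, update_of_ne hi]
        rw [← hrad i hi]; exact hx i
    refine ⟨purePacket p k y, integerPacket_le_normalizedPacket p k (purePacket_mem_integerPacket p k hy1), ?_⟩
    show iota p k i₀ g * purePacket p k y = PiTensorProduct.tprod ℚ_[p] (fun i => e i (x i))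
    rw [iota_mul_purePacket]
    simp only [y, update_self, update_idem, mul_inv_cancel_left₀ hg0, update_eq_self]
    rfl
  -- `N` is stable under the single-factor strip moves (realised in `H`; the span of the `H`-orbit is `H`-stable)
  have hNstrip : ∀ (i₁ : I), ∀ ψ ∈ ind1StripOf (w i₁) (galoisLog (w i₁)), ∀ z : Π i, k i,
      PiTensorProduct.tprod ℚ_[p] z ∈ N →
        PiTensorProduct.tprod ℚ_[p] (update z i₁ (e i₁ (ψ ((e i₁).symm (z i₁))))) ∈ N := by
    intro i₁ ψ hψ z hz
    obtain ⟨γ₀, hγ₀H, hγ₀⟩ := hstrip i₁ ψ hψ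
    have h := map_closure_iUnion_image_le p k M H hγ₀H ⟨_, hz, rfl⟩
    change γ₀ (PiTensorProduct.tprod ℚ_[p] z) ∈ N at h
    rwa [hγ₀ z] at h
  -- the total content of the box is `p^A`
  have hprod : ∏ i, cc i = (p : ℚ_[p]) ^ A := by
    rw [← Finset.mul_prod_erase Finset.univ cc (Finset.mem_univ i₀)]
    have h1 : ∏ i ∈ Finset.univ.erase i₀, cc i = ((p : ℚ_[p])⁻¹) ^ (Fintype.card I - 1) := by
      rw [Finset.prod_congr rfl (fun i hi => show cc i = (p : ℚ_[p])⁻¹ by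
        simp only [cc, if_neg (Finset.ne_of_mem_erase hi)]), Finset.prod_const,
        Finset.card_erase_of_mem (Finset.mem_univ _), Finset.card_univ]
    rw [h1]
    simp only [cc, if_pos rfl]
    rw [inv_pow, ← zpow_natCast, ← zpow_neg, ← zpow_add₀ hpQ]
    congr 1
    have hI : 1 ≤ Fintype.card I := Fintype.card_pos
    rw [hA, ha, Nat.cast_sub hI]
    push_cast
    ring
  -- the packet floor on `N`
  have hNc : (N : Set (PacketAlgebra p k)) ⊆ packetHull p k ((∏ i, cc i) • L) := by
    rw [hprod]; exact hNA.trans (subset_packetHull p k _)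
  have hfloor := packetHull_eq_of_balls_of_jannsenWingbergMappingClass p w hw hMC hp2 he h3 hodd cc hcc0 nn hnn1 hnne
    hexc N hbox hNstrip hNc
  rw [hprod] at hfloor
  rw [← packetHull_coe_closure_eq p k O]
  exact hfloor

end GenuineFactors

/-! ## §2 The genuine packet of a place section: the Θ-region of [IUTchIII] Cor. 3.12 and the readings -/

section PlaceSection

variable {F₀ : Type} [Field F₀] [NumberField F₀] {K : Type} [Field K] [NumberField K] [Algebra F₀ K]
variable (σ : PlaceSection F₀ K) (p : ℕ) [hp : Fact p.Prime]
variable (c : (j : ℕ) → (Fin (j + 1) → placesOver F₀ p) → ℚ_[p]) (hc0 : ∀ j e, c j e ≠ 0)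
  (hcσ : ∀ (j : ℕ) (τ : Equiv.Perm (Fin (j + 1))) (e : Fin (j + 1) → placesOver F₀ p), c j (e ∘ τ) = c j e)

/-- **THE PACKET–THETA JUNCTION (modulo `JannsenWingbergMappingClass`).**  Real prime packet over the GENUINE completions of a place
section (any shell normalisation), Θ-idele `t`, degree `j = i+1`, collection `v⃗ = e` with every factor `K_{v̲_b}` TAME (`p > 2`,
`e(v̲_b|p) ≤ p − 2`) of ODD local degree `≥ 3` and residue degree `≠ 1`.  For every subgroup `H` of the packet automorphisms INSIDE the
Dupuy–Hilado container `indTwo = Aut_{ℚ_p}(X : log_p(R_I^×))` (print's factorwise (Ind1)-strip ⊔ (Ind2) group is: p516014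
`mem_indTwo_of_printInd1Ind2`) that CONTAINS the single-factor (Ind1) strip moves `⊗ z ↦ ⊗ z[b₀ ↦ ψ z_{b₀}]`, `ψ ∈ Real.ind1StripOf v̲_{b₀}`:
the `(R_I)^∼`-hull of the `H`-orbit of the Θ-region `O_𝕃(−P_Θ)_{v⃗} = ι_j(t_{i,v_j})·(R_I)^∼` **equals** the hull of the slot images
(the full container orbit) — reading (P)'s region. [claim: Mochizuki2012, status: disputed] [cite: Mochizuki2012, IUTchIII Thm. 3.11 (i) p. 154;
Rmk. 3.9.5 (i) p. 127; Cor. 3.12 Step (x)/(xi) pp. 181–183; IUTchIV Prop. 1.2 (ii) p. 10–11] [cite: Kondo2025OuterAutMLF, §3 Thm 3.17, Rem 3.18]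
[cite: DupuyHilado2025, §4.9, §4.12] -/
theorem localFields_packetHull_orbitH_pilotRegion_eq_slotImagesHull_of_jannsenWingbergMappingClass
    (hMC : JannsenWingbergMappingClass) (hp2 : 2 < p) {lstar : ℕ}
    (t : Fin lstar → (v : placesOver F₀ p) → ((σ.localFields p).k v)ˣ) (i : Fin lstar)
    (e : Fin ((i : ℕ) + 1 + 1) → placesOver F₀ p)
    (he : ∀ b, absRamificationIdx p ((σ.localFields p).k (e b)) ≤ p - 2)
    (h3 : ∀ b, 3 ≤ localDeg K (σ.lift (e b).1)) (hodd : ∀ b, Odd (localDeg K (σ.lift (e b).1)))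
    (hf : ∀ b, (σ.lift (e b).1).asIdeal.inertiaDeg ℤ ≠ 1)
    (H : Subgroup (PacketAlgebra p (fun b => (σ.localFields p).k (e b)) ≃ₗ[ℚ_[p]]
      PacketAlgebra p (fun b => (σ.localFields p).k (e b))))
    (hH : H ≤ indTwo p (fun b => (σ.localFields p).k (e b)))
    (hstrip : ∀ (b₀ : Fin ((i : ℕ) + 1 + 1)),
      ∀ ψ ∈ ind1StripOf (σ.lift (e b₀).1) (galoisLog (σ.lift (e b₀).1)), ∃ γ ∈ H,
        ∀ z : ∀ b, (σ.localFields p).k (e b),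
          (γ : PacketAlgebra p (fun b => (σ.localFields p).k (e b)) ≃ₗ[ℚ_[p]]
              PacketAlgebra p (fun b => (σ.localFields p).k (e b))) (PiTensorProduct.tprod ℚ_[p] z) =
            PiTensorProduct.tprod ℚ_[p] (update z b₀
              (RescaledCompletion.of K p (σ.lift (e b₀).1) (σ.natCast_mem_lift (e b₀))
                (ψ ((RescaledCompletion.of K p (σ.lift (e b₀).1) (σ.natCast_mem_lift (e b₀))).symm (z b₀)))))) :
    packetHull p (fun b => (σ.localFields p).k (e b))
        (⋃ γ : H, (γ : PacketAlgebra p (fun b => (σ.localFields p).k (e b)) ≃ₗ[ℚ_[p]]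
            PacketAlgebra p (fun b => (σ.localFields p).k (e b))) ''
          (realPrimePacketWith p (σ.localFields p) c hc0 hcσ).pilotRegion t ((i : ℕ) + 1) e) =
      (realPrimePacketWith p (σ.localFields p) c hc0 hcσ).slotImagesHull
        ((realPrimePacketWith p (σ.localFields p) c hc0 hcσ).pilotRegion t) ((i : ℕ) + 1) e := by
  obtain ⟨v, hv⟩ := exists_norm_eq_rpow p ((σ.localFields p).k (e (Fin.last _))) (t i (e (Fin.last _))).ne_zero
  have hcore := packetHull_iUnion_image_iota_smul_normalizedPacket_eq_of_jannsenWingbergMappingClass p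
    (fun b => σ.lift (e b).1) (fun b => σ.natCast_mem_lift (e b)) hMC hp2 he h3 hodd hf (Fin.last _) hv H hH hstrip
  obtain ⟨-, hcont⟩ := packetHull_iUnion_image_iota_smul_normalizedPacket_subset_of_tame p
    (fun b => σ.lift (e b).1) (fun b => σ.natCast_mem_lift (e b)) hp2 he (Fin.last _) hv
    (indTwo p (fun b => (σ.localFields p).k (e b))) le_rfl
  refine Set.Subset.antisymm ?_ ?_
  · exact packetHull_mono p _
      (realPrimePacketWith_orbitH_subset_slotImages p (σ.localFields p) c hc0 hcσ t i e H hH)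
  · change packetHull p _ ((realPrimePacketWith p (σ.localFields p) c hc0 hcσ).slotImages _ _ e) ⊆ _
    rw [realPrimePacketWith_slotImages_pilotRegion_eq,
      Set.iUnion_congr (fun γ => indTwo_smul_set p (fun b => (σ.localFields p).k (e b)) γ _),
      realPrimePacketWith_pilotRegion_succ_eq]
    refine hcont.trans (le_of_eq ?_)
    exact hcore.symm

end PlaceSection

end Summit.ABC.IUTFork.Thm311.Real

end
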